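import Literature.NumberTheory.Sieve.MoebiusShiftedPrimesProofs
import HarnessLib

/-!
# Möbius on shifted primes — Theorem 2.2 of Lichtman 2020 from Proposition 2.3

Topic `Literature/NumberTheory/Sieve`, third layer of the decomposition of the named fact
`Literature.NumberTheory.Sieve.lichtman2020_moebius_shifted_primes_avg` (J. D. Lichtman, *Averages of the Möbius function on
shifted primes*, Q. J. Math. (2021), doi:10.1093/qmath/haab054, arXiv:2009.08969 [Lichtman2020],
Theorem 1.1, qualitative part), after `MoebiusShiftedPrimesProofs.lean` (Thm 1.1 ⇐ Thm 2.2 + (2.5))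
and `MoebiusShiftedPrimesSieveBound.lean` ((2.5) proved).  Page numbers refer to the held copy
`paper:arxiv-2009.08969`.

* `Lichtman2020_keyFourierEstimateLiouville` — NAMED FACT: Proposition 2.3 (p. 8), the key Fourier
  estimate for the Liouville function `λ` on the refined sets `S_d`, `d ≤ W = (log X)^A`:
  `sup_α ∫₀^X |∑_{x ≤ nd ≤ x+H, n ∈ S_d} λ(n) e(αn)| dx ≪_{A,δ} HX/(d^{3/4} W^{1/5})`.
* `Lichtman2020_keyFourierEstimate_of_liouville` — PROVED: Proposition 2.3 ⟹ Theorem 2.2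
  (`Lichtman2020_keyFourierEstimate` of `MoebiusShiftedPrimesProofs.lean`), i.e. the paper's
  "Proof of Theorem 2.2 from Proposition 2.3" (p. 8).

Hence `lichtman2020_moebius_shifted_primes_avg` now rests on Proposition 2.3 alone
(`lichtman2020_moebius_shifted_primes_avg_of_keyFourierEstimate'` ∘ this file).  The next layer in
print is Prop 2.3 ⇐ Prop 3.1 (minor arcs) + Prop 3.2 (major arcs) (p. 9).

## The proof (p. 8, made quantitative)

* `μ = λ ∗ h` with `h(d²) = μ(d)`: `μ(n) = ∑_{d² ∣ n} μ(d) λ(n/d²)` (`moebius_eq_sum_sq_dvd`; from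
  `n = b²a`, `a` squarefree, `d² ∣ n ↔ d ∣ b`, `∑_{d ∣ b} μ(d) = [b = 1]`, and `μ = λ` on squarefree
  numbers — Mathlib's `ArithmeticFunction.liouville`, `moebius_mul_coe_zeta`).
* Both integrals are integrals of step functions and are evaluated as finite sums over the unit
  intervals `(k-1, k)`: `integral_window_eq_sum` (previous file) and `integral_window_div_eq_sum`
  (here; the integers `n` with `x ≤ ne ≤ x + H` do not change on `(k-1, k)` since the break points
  `eℤ ∪ (eℤ - H)` are integers), the discrete divided window being `windowDiv e H k`.
* Rearrangement (`moebiusTwistedSum_filter_Icc_eq`):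
  `∑_{n ∈ {k..k+H-1} ∩ S} μ(n)e(nα) = ∑_d μ(d) ∑_{m ∈ windowDiv(d²,H,k), d²m ∈ S} λ(m) e(d²mα)`.
* `d ≤ M = ⌊√W⌋`: every prime factor of `d²` is `≤ √W = (log X)^{A/2} < P₁, P₂`, so
  `d²m ∈ S ↔ m ∈ S` (`lichtmanTypical_sq_mul_iff`) and Proposition 2.3 at frequency `d²α` bounds
  the `k`-sum by `C HX/(d^{3/2} W^{1/5})`; `∑_{d ≤ M} d^{-3/2} ≤ 3` (`sum_inv_sqrt_cube_le`).
* `d > M`: trivially `|∑_m …| ≤ #windowDiv(d², H, k)` and `∑_{k ≤ X} #windowDiv(e, H, k) ≤ H(X+H)/e`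
  (`sum_card_windowDiv_le`, counting pairs), so these `d` contribute
  `≤ 2HX ∑_{d > M} d⁻² ≤ 2HX/M ≤ 4HX/√W ≤ 4HX/W^{1/5}`.
* Total `(3C + 4) HX/W^{1/5}` (`keyFourier_fixed_bound`), eventually in `X`; the hypothesis
  `ψ(X) ≤ (log X)^{2/3}` of Proposition 2.3 follows from the regime `H ≤ exp((log X)^{2/3})` of
  Theorem 2.2 as recorded.

## Faithfulness notes

* Proposition 2.3 is rendered like Theorem 2.2 in `MoebiusShiftedPrimesProofs.lean`: `X : ℕ`,
  `H : ℕ → ℕ` with `ψ(X) = log H(X)/log log X → ∞`; "`ψ(X) ≤ (log X)^{2/3}`" is kept as printed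
  (eventually in `X`); `S_d = {m ≤ X/d : …}` is the typical-factorisation predicate `lichtmanTypical`
  on `m` (with `Q₁ = H/(log X)^{4A}`), the cut-off `m ≤ X/d` being displayed by the range
  `x ≤ md ≤ x + H`, `x ≤ X` (it is exceeded only for `x > X - H`, by `≤ H/d + 1` terms);
  "`≪_{A,δ}`", uniform in `d ≤ W` and in `α`, is `∃ C, ∀ᶠ X, ∀ d, 1 ≤ d ≤ (log X)^A, ∀ α`.
* The deduction in print bounds the `d > W` tail by `HX/W^{1/4}` using `|h| ≤ 1` supported on
  squares; here the split is at `d² ≤ W` versus `d² > W` with the same outcome `≪ HX/W^{1/5}`.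

## Source

* J. D. Lichtman, *Averages of the Möbius function on shifted primes*, arXiv:2009.08969, §2:
  Theorem 2.2 (p. 7), (2.8), Proposition 2.3 and the proof of Theorem 2.2 from it (p. 8).
-/

open Filter Asymptotics Finset MeasureTheory
open scoped FourierTransform Topology

namespace Literature.NumberTheory.Sieve

/-! ### Proposition 2.3 (key Fourier estimate for `λ`) -/

/-- The twisted Liouville sum over a finset: `∑_{n ∈ s} λ(n) e(nα)` (`λ` = Mathlib's
`ArithmeticFunction.liouville`, `e(x) = exp(2πix)` = `Real.fourierChar`). [cite: Lichtman2020, Proposition 2.3] -/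
noncomputable def liouvilleTwistedSum (s : Finset ℕ) (α : ℝ) : ℂ :=
  ∑ n ∈ s, ((ArithmeticFunction.liouville n : ℤ) : ℂ) * (𝐞 (n * α) : ℂ)

/-- NAMED FACT — **Lichtman 2020, Proposition 2.3 (key Fourier estimate for `λ`)**, as printed:
"Given any `A > 5`, `δ > 0`, `H = (log X)^{ψ(X)}` with `ψ(X) → ∞` and `ψ(X) ≤ (log X)^{2/3}`. For
`d ≤ W = (log X)^A` and `S_d = S_d(X, A, δ)` as in (2.8), we have
`sup_α ∫_0^X |∑_{x ≤ nd ≤ x+H, n ∈ S_d} λ(n) e(αn)| dx ≪_{A,δ} HX/(d^{3/4} W^{1/5})`", where (2.8):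
"`S_d = S_d(X,A,δ) = {m ≤ X/d : ∃ prime factors p₁, p₂ ∣ m with p_j ∈ [P_j, Q_j]}`".
Rendering (as for Theorem 2.2 in `MoebiusShiftedPrimesProofs`): `X : ℕ`; `H : ℕ → ℕ` with
`ψ(X) = log H(X)/log log X → ∞` and `ψ(X) ≤ (log X)^{2/3}` eventually; the integers `n` with
`x ≤ nd ≤ x + H` are `Icc ⌈x/d⌉₊ ⌊(x+H)/d⌋₊`; `n ∈ S_d` is the typical-factorisation predicate
`lichtmanTypical X A δ H n` (the cut-off `m ≤ X/d` is displayed by the range, which exceeds it only for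
`x > X - H`); "`≪_{A,δ}`", uniform in `d ≤ W` and `α`, is `∃ C, ∀ᶠ X, ∀ d, 1 ≤ d ≤ (log X)^A → ∀ α`.
Users take `(h : Lichtman2020_keyFourierEstimateLiouville)`. [cite: Lichtman2020, Proposition 2.3] -/
def Lichtman2020_keyFourierEstimateLiouville : Prop :=
  ∀ A : ℝ, 5 < A → ∀ δ : ℝ, 0 < δ → ∀ H : ℕ → ℕ,
    Tendsto (fun X : ℕ => Real.log (H X) / Real.log (Real.log X)) atTop atTop →
    (∀ᶠ X : ℕ in atTop, Real.log (H X) / Real.log (Real.log X) ≤ Real.log X ^ (2 / 3 : ℝ)) →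
    ∃ C : ℝ, ∀ᶠ X : ℕ in atTop, ∀ d : ℕ, 1 ≤ d → (d : ℝ) ≤ Real.log X ^ A → ∀ α : ℝ,
      ∫ x in (0 : ℝ)..X,
          ‖liouvilleTwistedSum
              ((Icc ⌈x / d⌉₊ ⌊(x + H X) / d⌋₊).filter (lichtmanTypical X A δ (H X))) α‖
        ≤ C * ((H X : ℝ) * X / ((d : ℝ) ^ (3 / 4 : ℝ) * Real.log X ^ (A / 5)))

namespace Lichtman2020

/-! ### The divided window and its discretisation -/

/-- The integers `m` with `k ≤ m e ≤ k + H - 1`, i.e. with `m e` in the discrete window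
`{k, …, k + H - 1}`. [folklore] -/
def windowDiv (e H k : ℕ) : Finset ℕ :=
  {m ∈ range (k + H) | k ≤ m * e ∧ m * e ≤ k + H - 1}

/-- Membership in the divided window (`k ≥ 1`). [folklore] -/
theorem mem_windowDiv {e H k m : ℕ} (hk : 1 ≤ k) :
    m ∈ windowDiv e H k ↔ k ≤ m * e ∧ m * e ≤ k + H - 1 := by
  unfold windowDiv
  rw [Finset.mem_filter, Finset.mem_range]
  constructor
  · exact fun h => h.2
  · intro h
    refine ⟨?_, h⟩
    rcases Nat.eq_zero_or_pos e with rfl | he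
    · rw [Nat.mul_zero] at h; omega
    · have := Nat.le_mul_of_pos_right m he
      omega

/-- On `x ∈ (k-1, k)` (`k ≥ 1`) the integers `n` with `x ≤ n e ≤ x + H` (`e ≥ 1`), i.e.
`Icc ⌈x/e⌉₊ ⌊(x+H)/e⌋₊`, form the divided window `windowDiv e H k`. [folklore] -/
theorem Icc_ceil_floor_div_eq {x : ℝ} {k H e : ℕ} (hk : 1 ≤ k) (he : 1 ≤ e)
    (h1 : (k : ℝ) - 1 < x) (h2 : x < k) :
    Icc ⌈x / e⌉₊ ⌊(x + H) / e⌋₊ = windowDiv e H k := by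
  have he0 : (0 : ℝ) < e := by exact_mod_cast he
  have hx0 : 0 ≤ x := by
    have : (1 : ℝ) ≤ k := by exact_mod_cast hk
    linarith
  ext m
  rw [Finset.mem_Icc, mem_windowDiv hk, Nat.ceil_le, Nat.le_floor_iff (by positivity),
    div_le_iff₀ he0, le_div_iff₀ he0]
  constructor
  · rintro ⟨h3, h4⟩
    constructor
    · have h5 : (k : ℝ) < (m * e : ℕ) + 1 := by push_cast; linarith
      have h6 : k < m * e + 1 := by exact_mod_cast h5
      omega
    · have h5 : ((m * e : ℕ) : ℝ) < (k + H : ℕ) := by push_cast; linarith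
      have h6 : m * e < k + H := by exact_mod_cast h5
      omega
  · rintro ⟨h3, h4⟩
    constructor
    · have h5 : (k : ℝ) ≤ (m * e : ℕ) := by exact_mod_cast h3
      push_cast at h5
      linarith
    · have h5 : m * e + 1 ≤ k + H := by omega
      have h6 : ((m * e + 1 : ℕ) : ℝ) ≤ ((k + H : ℕ) : ℝ) := by exact_mod_cast h5
      push_cast at h6
      linarith

/-- **Discretisation of the window integral of Proposition 2.3**: for integers `N, H` and `e ≥ 1`,
`∫₀^N F({n : x ≤ ne ≤ x + H}) dx = ∑_{k=1}^{N} F(windowDiv e H k)` (the integrand is constant on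
each `(k-1, k)`, the break points `x ∈ eℤ ∪ (eℤ - H)` being integers). [folklore] -/
theorem integral_window_div_eq_sum (F : Finset ℕ → ℝ) (N H e : ℕ) (he : 1 ≤ e) :
    ∫ x in (0 : ℝ)..N, F (Icc ⌈x / e⌉₊ ⌊(x + H) / e⌋₊) = ∑ k ∈ Icc 1 N, F (windowDiv e H k) := by
  have hint : ∀ k < N, IntervalIntegrable (fun x : ℝ => F (Icc ⌈x / e⌉₊ ⌊(x + H) / e⌋₊)) volume
      ((fun k : ℕ => (k : ℝ)) k) ((fun k : ℕ => (k : ℝ)) (k + 1)) := by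
    intro k hk
    refine (intervalIntegrable_const (c := F (windowDiv e H (k + 1)))).congr_uIoo ?_
    intro x hx
    rw [Set.uIoo_of_le (by push_cast; linarith)] at hx
    simp only
    rw [Icc_ceil_floor_div_eq (k := k + 1) (by omega) he (by push_cast; linarith [hx.1])
      (by simpa using hx.2)]
  have hsplit := intervalIntegral.sum_integral_adjacent_intervals hint
  simp only [Nat.cast_zero] at hsplit
  rw [← hsplit, sum_Icc_one_eq_sum_range]
  refine Finset.sum_congr rfl fun k _ => ?_
  have hle : ((k : ℕ) : ℝ) ≤ ((k + 1 : ℕ) : ℝ) := by push_cast; linarith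
  rw [intervalIntegral.integral_congr_Ioo_of_le (g := fun _ => F (windowDiv e H (k + 1))) hle ?_]
  · rw [intervalIntegral.integral_const]
    push_cast
    ring
  · intro x hx
    simp only
    rw [Icc_ceil_floor_div_eq (k := k + 1) (by omega) he (by push_cast; linarith [hx.1])
      (by simpa using hx.2)]

/-- The plain window is the divided window with `e = 1`. [folklore] -/
theorem windowDiv_one (H k : ℕ) (hk : 1 ≤ k) : windowDiv 1 H k = Icc k (k + H - 1) := by
  ext m
  rw [mem_windowDiv hk, Finset.mem_Icc, Nat.mul_one]

/-- **Pair counting**: `∑_{k=1}^{N} #windowDiv(e, H, k) ≤ H (N + H)/e` (`e, H ≥ 1`): each `m` with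
`1 ≤ me ≤ N + H - 1` lies in at most `H` windows, and there are `≤ (N + H - 1)/e` of them. [folklore] -/
theorem sum_card_windowDiv_le (N H e : ℕ) (he : 1 ≤ e) (hH : 1 ≤ H) :
    (∑ k ∈ Icc 1 N, (#(windowDiv e H k) : ℝ)) ≤ (H : ℝ) * ((N : ℝ) + H) / e := by
  -- write the cardinalities as indicator sums over a common range and swap
  have hcard : ∀ k ∈ Icc 1 N, #(windowDiv e H k) =
      ∑ m ∈ range (N + H), if k ≤ m * e ∧ m * e ≤ k + H - 1 then 1 else 0 := by
    intro k hk
    rw [Finset.mem_Icc] at hk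
    rw [Finset.sum_boole, Nat.cast_id]
    congr 1
    ext m
    rw [mem_windowDiv hk.1, Finset.mem_filter, Finset.mem_range]
    constructor
    · intro h
      refine ⟨?_, h⟩
      have := Nat.le_mul_of_pos_right m (by omega : 0 < e)
      omega
    · exact fun h => h.2
  have hswap : ∑ k ∈ Icc 1 N, #(windowDiv e H k) =
      ∑ m ∈ range (N + H), ∑ k ∈ Icc 1 N, (if k ≤ m * e ∧ m * e ≤ k + H - 1 then 1 else 0) := by
    rw [Finset.sum_congr rfl hcard, Finset.sum_comm]
  -- each `m` is counted at most `H` times, and only if `1 ≤ me ≤ N + H - 1`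
  have hinner : ∀ m ∈ range (N + H),
      ∑ k ∈ Icc 1 N, (if k ≤ m * e ∧ m * e ≤ k + H - 1 then 1 else 0) ≤
        if 1 ≤ m * e ∧ m * e ≤ N + H - 1 then H else 0 := by
    intro m _
    rw [Finset.sum_boole, Nat.cast_id]
    split_ifs with hm
    · calc #{k ∈ Icc 1 N | k ≤ m * e ∧ m * e ≤ k + H - 1}
          ≤ #(Icc (m * e - (H - 1)) (m * e)) := by
            refine Finset.card_le_card fun k hk => ?_
            rw [Finset.mem_filter, Finset.mem_Icc] at hk
            rw [Finset.mem_Icc]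
            omega
        _ ≤ H := by
            rw [Nat.card_Icc]
            generalize m * e = t
            omega
    · rw [Nat.le_zero, Finset.card_eq_zero, Finset.filter_eq_empty_iff]
      intro k hk
      rw [Finset.mem_Icc] at hk
      omega
  have hcount : #{m ∈ range (N + H) | 1 ≤ m * e ∧ m * e ≤ N + H - 1} ≤ (N + H - 1) / e := by
    calc #{m ∈ range (N + H) | 1 ≤ m * e ∧ m * e ≤ N + H - 1} ≤ #(Icc 1 ((N + H - 1) / e)) := by
          refine Finset.card_le_card fun m hm => ?_
          rw [Finset.mem_filter] at hm
          rw [Finset.mem_Icc, Nat.le_div_iff_mul_le (by omega)]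
          refine ⟨?_, hm.2.2⟩
          rcases Nat.eq_zero_or_pos m with rfl | h0
          · simp at hm
          · exact h0
      _ = (N + H - 1) / e := by rw [Nat.card_Icc, Nat.add_sub_cancel]
  have hnat : ∑ k ∈ Icc 1 N, #(windowDiv e H k) ≤ H * ((N + H - 1) / e) := by
    rw [hswap]
    calc ∑ m ∈ range (N + H), ∑ k ∈ Icc 1 N, (if k ≤ m * e ∧ m * e ≤ k + H - 1 then 1 else 0)
        ≤ ∑ m ∈ range (N + H), (if 1 ≤ m * e ∧ m * e ≤ N + H - 1 then H else 0) :=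
          Finset.sum_le_sum hinner
      _ = H * #{m ∈ range (N + H) | 1 ≤ m * e ∧ m * e ≤ N + H - 1} := by
          rw [← Finset.sum_filter, Finset.sum_const, smul_eq_mul, mul_comm]
      _ ≤ H * ((N + H - 1) / e) := Nat.mul_le_mul_left _ hcount
  have he0 : (0 : ℝ) < e := by exact_mod_cast he
  calc (∑ k ∈ Icc 1 N, (#(windowDiv e H k) : ℝ)) = ((∑ k ∈ Icc 1 N, #(windowDiv e H k) : ℕ) : ℝ) := by
        push_cast; rfl
    _ ≤ ((H * ((N + H - 1) / e) : ℕ) : ℝ) := by exact_mod_cast hnat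
    _ = (H : ℝ) * (((N + H - 1) / e : ℕ) : ℝ) := by push_cast; ring
    _ ≤ (H : ℝ) * (((N + H - 1 : ℕ) : ℝ) / e) :=
        mul_le_mul_of_nonneg_left (Nat.cast_div_le) (Nat.cast_nonneg _)
    _ ≤ (H : ℝ) * (((N : ℝ) + H) / e) := by
        apply mul_le_mul_of_nonneg_left _ (Nat.cast_nonneg _)
        apply div_le_div_of_nonneg_right _ he0.le
        have : ((N + H - 1 : ℕ) : ℝ) ≤ ((N + H : ℕ) : ℝ) := by exact_mod_cast Nat.sub_le _ _
        push_cast at this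
        exact this
    _ = (H : ℝ) * ((N : ℝ) + H) / e := by ring

end Lichtman2020

end Literature.NumberTheory.Sieve

namespace Literature.NumberTheory.Sieve.Lichtman2020

open ArithmeticFunction

/-! ### `μ = λ ∗ h`: `μ(n) = ∑_{d² ∣ n} μ(d) λ(n/d²)` -/

/-- `d² ∣ b² a` with `a` squarefree iff `d ∣ b`. [folklore] -/
theorem sq_dvd_sq_mul_iff {a b d : ℕ} (ha : Squarefree a) : d ^ 2 ∣ b ^ 2 * a ↔ d ∣ b := by
  constructor
  · intro h
    rcases Nat.eq_zero_or_pos d with rfl | hd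
    · rw [zero_pow two_ne_zero, zero_dvd_iff, mul_eq_zero] at h
      rcases h with h | h
      · rw [(pow_eq_zero_iff two_ne_zero).mp h]
      · exact absurd ha (h ▸ not_squarefree_zero)
    obtain ⟨d', b', hco, hd', hb'⟩ := Nat.exists_coprime d b
    have hg0 : 0 < Nat.gcd d b := Nat.gcd_pos_of_pos_left b hd
    have h1 : d' ^ 2 ∣ b' ^ 2 * a := by
      have h2 : (d' * Nat.gcd d b) ^ 2 ∣ (b' * Nat.gcd d b) ^ 2 * a := by rw [← hd', ← hb']; exact h
      rw [mul_pow, mul_pow, show b' ^ 2 * Nat.gcd d b ^ 2 * a = (b' ^ 2 * a) * Nat.gcd d b ^ 2 by ring]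
        at h2
      exact Nat.dvd_of_mul_dvd_mul_right (pow_pos hg0 2) h2
    have h3 : d' ^ 2 ∣ a := (Nat.Coprime.pow 2 2 hco).dvd_of_dvd_mul_left h1
    have h4 : IsUnit d' := ha d' (by rw [← pow_two]; exact h3)
    rw [Nat.isUnit_iff] at h4
    rw [hd', h4, one_mul]
    exact Nat.gcd_dvd_right d b
  · intro h
    exact (pow_dvd_pow_of_dvd h 2).mul_right a

/-- `|λ(n)| ≤ 1`. [folklore] -/
theorem abs_liouville_le_one (n : ℕ) : |liouville n| ≤ 1 := by
  rcases Nat.eq_zero_or_pos n with rfl | hn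
  · simp
  · rw [liouville_apply hn.ne', abs_pow, abs_neg, abs_one, one_pow]

/-- `λ(d²) = 1` (`d ≠ 0`). [folklore] -/
theorem liouville_sq {d : ℕ} (hd : d ≠ 0) : liouville (d ^ 2) = 1 := by
  rw [pow_two, liouville_apply_mul, liouville_apply hd, ← pow_add, ← two_mul, pow_mul]
  norm_num

/-- **`μ = λ ∗ h` with `h(d²) = μ(d)`** ("By Möbius inversion, we have `μ = λ ∗ h` for
`h = μ ∗ (μλ)` … `h(d²) = μ(d)` for squarefree `d`, and zero otherwise", p. 8): for `n ≥ 1`,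
`μ(n) = ∑_{d ≥ 1, d² ∣ n} μ(d) λ(n/d²)`.  Proof: write `n = b² a` with `a` squarefree; then
`d² ∣ n ↔ d ∣ b`, `λ(n/d²) = λ(n)`, and `∑_{d ∣ b} μ(d) = [b = 1] = [n squarefree]`, while
`μ = λ` on squarefree numbers. [cite: Lichtman2020, §2, proof of Theorem 2.2 from Proposition 2.3] -/
theorem moebius_eq_sum_sq_dvd {n : ℕ} (hn : 0 < n) :
    moebius n = ∑ d ∈ (Icc 1 n).filter (fun d => d ^ 2 ∣ n), moebius d * liouville (n / d ^ 2) := by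
  obtain ⟨a, b, ha0, hb0, hba, ha⟩ := Nat.sq_mul_squarefree_of_pos hn
  have hset : (Icc 1 n).filter (fun d => d ^ 2 ∣ n) = b.divisors := by
    ext d
    rw [Finset.mem_filter, Finset.mem_Icc, Nat.mem_divisors, ← hba, sq_dvd_sq_mul_iff ha]
    constructor
    · exact fun h => ⟨h.2, hb0.ne'⟩
    · intro h
      refine ⟨⟨Nat.pos_of_dvd_of_pos h.1 hb0, ?_⟩, h.1⟩
      calc d ≤ b := Nat.le_of_dvd hb0 h.1
        _ ≤ b ^ 2 * a := by nlinarith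
  have hterm : ∀ d ∈ b.divisors, moebius d * liouville (n / d ^ 2) = moebius d * liouville n := by
    intro d hd
    rw [Nat.mem_divisors] at hd
    have hdn : d ^ 2 ∣ n := by rw [← hba]; exact (sq_dvd_sq_mul_iff ha).mpr hd.1
    have hd0 : d ≠ 0 := (Nat.pos_of_dvd_of_pos hd.1 hb0).ne'
    congr 1
    have hmul : liouville (n / d ^ 2) * liouville (d ^ 2) = liouville n := by
      rw [← liouville_apply_mul, Nat.div_mul_cancel hdn]
    rw [← hmul, liouville_sq hd0, mul_one]
  rw [hset, Finset.sum_congr rfl hterm, ← Finset.sum_mul]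
  have hmob : ∑ d ∈ b.divisors, moebius d = if b = 1 then 1 else 0 := by
    have := congrArg (fun f : ArithmeticFunction ℤ => f b) moebius_mul_coe_zeta
    simp only [coe_mul_zeta_apply, one_apply] at this
    exact this
  rw [hmob]
  split_ifs with hb1
  · subst hb1
    have hna : n = a := by rw [← hba]; ring
    rw [one_mul, hna, moebius_apply_of_squarefree ha, liouville_apply ha0.ne']
  · rw [zero_mul]
    apply moebius_eq_zero_of_not_squarefree
    intro hsq
    have : IsUnit b := hsq b (by rw [← hba, ← pow_two]; exact Dvd.intro _ rfl)
    rw [Nat.isUnit_iff] at this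
    exact hb1 this

/-! ### Rearrangement of the twisted Möbius sum -/

/-- `∑_{n ∈ {k..k+H-1} ∩ S} μ(n) e(nα) = ∑_{d ≤ D} μ(d) ∑_{m ∈ windowDiv(d², H, k), d²m ∈ S} λ(m) e(d²mα)`
(`D ≥ k + H - 1`, `k ≥ 1`): the identity `μ(n) = ∑_{d² ∣ n} μ(d) λ(n/d²)` followed by `n = d²m`.
[cite: Lichtman2020, §2, (2.9)] -/
theorem moebiusTwistedSum_filter_Icc_eq (k H D : ℕ) (hk : 1 ≤ k) (hD : k + H - 1 ≤ D)
    (S : ℕ → Prop) [DecidablePred S] (α : ℝ) :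
    moebiusTwistedSum ((Icc k (k + H - 1)).filter S) α =
      ∑ d ∈ Icc 1 D, ((moebius d : ℤ) : ℂ) *
        ∑ m ∈ (windowDiv (d ^ 2) H k).filter (fun m => S (d ^ 2 * m)),
          ((liouville m : ℤ) : ℂ) * (𝐞 (((d ^ 2 * m : ℕ) : ℝ) * α) : ℂ) := by
  unfold moebiusTwistedSum
  have h1 : ∀ n ∈ (Icc k (k + H - 1)).filter S,
      ((moebius n : ℤ) : ℂ) * (𝐞 ((n : ℝ) * α) : ℂ) =
        ∑ d ∈ Icc 1 D, if d ^ 2 ∣ n then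
          ((moebius d : ℤ) : ℂ) * (((liouville (n / d ^ 2) : ℤ) : ℂ) * (𝐞 ((n : ℝ) * α) : ℂ))
          else 0 := by
    intro n hn
    rw [Finset.mem_filter, Finset.mem_Icc] at hn
    have hn0 : 0 < n := by omega
    rw [moebius_eq_sum_sq_dvd hn0]
    push_cast
    rw [Finset.sum_mul, Finset.sum_filter]
    simp_rw [mul_assoc]
    apply Finset.sum_subset (Finset.Icc_subset_Icc_right (by omega))
    intro d hd hdn
    rw [Finset.mem_Icc] at hd hdn
    rw [if_neg]
    intro hdvd
    have h2 := Nat.le_of_dvd hn0 hdvd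
    have h3 : d ≤ d ^ 2 := Nat.le_self_pow two_ne_zero d
    omega
  rw [Finset.sum_congr rfl h1, Finset.sum_comm]
  refine Finset.sum_congr rfl fun d hd => ?_
  rw [Finset.mem_Icc] at hd
  have hd2 : 0 < d ^ 2 := pow_pos (by omega) 2
  rw [← Finset.sum_filter, Finset.mul_sum]
  symm
  refine Finset.sum_nbij' (fun m => d ^ 2 * m) (fun n => n / d ^ 2) ?_ ?_ ?_ ?_ ?_
  · intro m hm
    rw [Finset.mem_filter, mem_windowDiv hk] at hm
    rw [Finset.mem_filter, Finset.mem_filter, Finset.mem_Icc]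
    refine ⟨⟨⟨?_, ?_⟩, hm.2⟩, dvd_mul_right _ _⟩
    · rw [mul_comm]; exact hm.1.1
    · rw [mul_comm]; exact hm.1.2
  · intro n hn
    rw [Finset.mem_filter, Finset.mem_filter, Finset.mem_Icc] at hn
    rw [Finset.mem_filter, mem_windowDiv hk, Nat.div_mul_cancel hn.2, Nat.mul_div_cancel' hn.2]
    exact ⟨hn.1.1, hn.1.2⟩
  · intro m _
    exact Nat.mul_div_cancel_left m hd2
  · intro n hn
    rw [Finset.mem_filter] at hn
    exact Nat.mul_div_cancel' hn.2
  · intro m _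
    rw [Nat.mul_div_cancel_left m hd2]

/-! ### The deduction at a fixed `X` -/

/-- `((d²))^{3/4} = (√d)³`. [folklore] -/
theorem natCast_sq_rpow_three_quarters (d : ℕ) :
    ((d ^ 2 : ℕ) : ℝ) ^ (3 / 4 : ℝ) = Real.sqrt d ^ 3 := by
  have hd : (0 : ℝ) ≤ d := Nat.cast_nonneg _
  push_cast
  rw [← Real.rpow_natCast (d : ℝ) 2, ← Real.rpow_mul hd, Real.sqrt_eq_rpow, ← Real.rpow_natCast,
    ← Real.rpow_mul hd]
  norm_num

/-- Telescoping: `∑_{d=1}^{M} (√d)⁻³ ≤ 3 - 2/√M ≤ 3`. [folklore] -/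
theorem sum_inv_sqrt_cube_le (M : ℕ) (hM : 1 ≤ M) :
    ∑ d ∈ Icc 1 M, (Real.sqrt d ^ 3)⁻¹ ≤ 3 - 2 / Real.sqrt M := by
  induction M with
  | zero => omega
  | succ n ih =>
    rcases Nat.eq_zero_or_pos n with rfl | hn
    · simp; norm_num
    · rw [Finset.sum_Icc_succ_top (by omega)]
      have ih' := ih hn
      -- `(√(n+1))⁻³ ≤ 2/√n - 2/√(n+1)`
      have hs : 0 < Real.sqrt n := Real.sqrt_pos.mpr (by exact_mod_cast hn)
      have ht : 0 < Real.sqrt ((n + 1 : ℕ) : ℝ) := Real.sqrt_pos.mpr (by positivity)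
      have hst : Real.sqrt n ≤ Real.sqrt ((n + 1 : ℕ) : ℝ) :=
        Real.sqrt_le_sqrt (by push_cast; linarith)
      have hdiff : Real.sqrt ((n + 1 : ℕ) : ℝ) ^ 2 - Real.sqrt n ^ 2 = 1 := by
        rw [Real.sq_sqrt (by positivity), Real.sq_sqrt (by positivity)]; push_cast; ring
      have key : (Real.sqrt ((n + 1 : ℕ) : ℝ) ^ 3)⁻¹ ≤ 2 / Real.sqrt n - 2 / Real.sqrt ((n + 1 : ℕ) : ℝ) := by
        rw [div_sub_div _ _ hs.ne' ht.ne', le_div_iff₀ (mul_pos hs ht), ← one_div, div_mul_eq_mul_div,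
          one_mul, div_le_iff₀ (by positivity)]
        -- s t ≤ (2t - 2s) t³  where t² - s² = 1, s ≤ t
        nlinarith [mul_pos hs ht, sq_nonneg (Real.sqrt ((n + 1 : ℕ) : ℝ) - Real.sqrt n)]
      linarith

/-- **Theorem 2.2 from Proposition 2.3 at a fixed `X`** (the core of "Proof of Theorem 2.2 from
Proposition 2.3", p. 8, in discretised form).  Hypotheses: the discretised Proposition 2.3 bound
`hP23` for every `1 ≤ e ≤ W` and every frequency, and the invariance `hS` of the set `S` under
multiplication by squares `d² ≤ M²` (in the application, `d² ≤ W < P₁`).  Then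
`∑_{k ≤ X} |∑_{n ∈ {k..k+H-1} ∩ S} μ(n)e(nα)| ≤ (3C + 4) HX/W^{1/5}`: the `d ≤ M = ⌊√W⌋` are fed to
Proposition 2.3 (`∑_d d^{-3/2} ≤ 3`), the `d > M` are counted trivially
(`∑_k #windowDiv(d², H, k) ≤ 2HX/d²`, `∑_{d > M} d⁻² ≤ 1/M ≤ 2/√W`). [cite: Lichtman2020, §2, (2.9)–(2.11)] -/
theorem keyFourier_fixed_bound {X H M D : ℕ} {W C : ℝ} (S : ℕ → Prop) [DecidablePred S] (α : ℝ)
    (hH : 1 ≤ H) (hHX : H ≤ X) (hW4 : 4 ≤ W) (hM : M = ⌊Real.sqrt W⌋₊) (hD : X + H ≤ D) (hC : 0 ≤ C)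
    (hP23 : ∀ e : ℕ, 1 ≤ e → (e : ℝ) ≤ W → ∀ β : ℝ,
      ∑ k ∈ Icc 1 X, ‖liouvilleTwistedSum ((windowDiv e H k).filter S) β‖ ≤
        C * ((H : ℝ) * X / ((e : ℝ) ^ (3 / 4 : ℝ) * W ^ (1 / 5 : ℝ))))
    (hS : ∀ d : ℕ, 1 ≤ d → d ≤ M → ∀ m : ℕ, S (d ^ 2 * m) ↔ S m) :
    ∑ k ∈ Icc 1 X, ‖moebiusTwistedSum ((Icc k (k + H - 1)).filter S) α‖ ≤
      (3 * C + 4) * ((H : ℝ) * X / W ^ (1 / 5 : ℝ)) := by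
  have hW0 : 0 < W := by linarith
  have hW1 : 1 ≤ W := by linarith
  have hX0 : (0 : ℝ) ≤ X := Nat.cast_nonneg _
  have hH0 : (0 : ℝ) ≤ H := Nat.cast_nonneg _
  have hHX' : (H : ℝ) ≤ X := by exact_mod_cast hHX
  have hW5 : 0 < W ^ (1 / 5 : ℝ) := Real.rpow_pos_of_pos hW0 _
  -- `M`
  have hsW2 : 2 ≤ Real.sqrt W := by
    rw [show (2 : ℝ) = Real.sqrt 4 by
      rw [show (4 : ℝ) = 2 ^ 2 by norm_num, Real.sqrt_sq (by norm_num : (0 : ℝ) ≤ 2)]]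
    exact Real.sqrt_le_sqrt hW4
  have hMle : (M : ℝ) ≤ Real.sqrt W := by rw [hM]; exact Nat.floor_le (Real.sqrt_nonneg _)
  have hMlt : Real.sqrt W < M + 1 := by rw [hM]; exact Nat.lt_floor_add_one _
  have hM2 : 2 ≤ M := by rw [hM]; exact Nat.le_floor (by exact_mod_cast hsW2)
  have hM1 : 1 ≤ M := by omega
  have hM0 : (0 : ℝ) < M := by exact_mod_cast (by omega : 0 < M)
  have hMhalf : Real.sqrt W / 2 ≤ M := by linarith
  -- the inner sums
  set T : ℕ → ℕ → ℂ := fun d k =>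
    ∑ m ∈ (windowDiv (d ^ 2) H k).filter (fun m => S (d ^ 2 * m)),
      ((liouville m : ℤ) : ℂ) * (𝐞 (((d ^ 2 * m : ℕ) : ℝ) * α) : ℂ) with hT
  -- step 1: pointwise in `k`
  have hstep1 : ∀ k ∈ Icc 1 X, ‖moebiusTwistedSum ((Icc k (k + H - 1)).filter S) α‖ ≤
      ∑ d ∈ Icc 1 D, ‖T d k‖ := by
    intro k hk
    rw [Finset.mem_Icc] at hk
    rw [moebiusTwistedSum_filter_Icc_eq k H D hk.1 (by omega) S α]
    refine (norm_sum_le _ _).trans (Finset.sum_le_sum fun d _ => ?_)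
    rw [norm_mul]
    have hμ : ‖((moebius d : ℤ) : ℂ)‖ ≤ 1 := by
      rw [Complex.norm_intCast]
      exact_mod_cast (abs_moebius_le_one (n := d))
    calc ‖((moebius d : ℤ) : ℂ)‖ * ‖T d k‖ ≤ 1 * ‖T d k‖ :=
          mul_le_mul_of_nonneg_right hμ (norm_nonneg _)
      _ = ‖T d k‖ := one_mul _
  -- step 2: trivial bound `‖T d k‖ ≤ #windowDiv(d², H, k)`
  have htriv : ∀ d k, ‖T d k‖ ≤ #(windowDiv (d ^ 2) H k) := by
    intro d k
    refine (norm_sum_le _ _).trans ?_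
    calc ∑ m ∈ (windowDiv (d ^ 2) H k).filter (fun m => S (d ^ 2 * m)),
          ‖((liouville m : ℤ) : ℂ) * (𝐞 (((d ^ 2 * m : ℕ) : ℝ) * α) : ℂ)‖
        ≤ ∑ m ∈ (windowDiv (d ^ 2) H k).filter (fun m => S (d ^ 2 * m)), (1 : ℝ) := by
          refine Finset.sum_le_sum fun m _ => ?_
          rw [norm_mul, Complex.norm_intCast, norm_fourierChar, mul_one]
          exact_mod_cast abs_liouville_le_one m
      _ = #((windowDiv (d ^ 2) H k).filter (fun m => S (d ^ 2 * m))) := by simp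
      _ ≤ #(windowDiv (d ^ 2) H k) := by exact_mod_cast Finset.card_filter_le _ _
  -- step 3: for `d ≤ M`, `T d k` is the integrand of Proposition 2.3 at `β = d²α`
  have hsmall : ∀ d ∈ Icc 1 M, ∑ k ∈ Icc 1 X, ‖T d k‖ ≤
      C * ((H : ℝ) * X / W ^ (1 / 5 : ℝ)) * (Real.sqrt d ^ 3)⁻¹ := by
    intro d hd
    rw [Finset.mem_Icc] at hd
    have hTeq : ∀ k, T d k = liouvilleTwistedSum ((windowDiv (d ^ 2) H k).filter S) ((d : ℝ) ^ 2 * α) := by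
      intro k
      rw [hT, liouvilleTwistedSum]
      simp only
      rw [Finset.filter_congr (fun m _ => hS d hd.1 hd.2 m)]
      refine Finset.sum_congr rfl fun m _ => ?_
      congr 2
      push_cast
      ring
    simp_rw [hTeq]
    have he1 : 1 ≤ d ^ 2 := Nat.one_le_pow _ _ hd.1
    have heW : ((d ^ 2 : ℕ) : ℝ) ≤ W := by
      have h1 : (d : ℝ) ≤ Real.sqrt W := le_trans (by exact_mod_cast hd.2) hMle
      have h2 : (d : ℝ) ^ 2 ≤ Real.sqrt W ^ 2 := pow_le_pow_left₀ (Nat.cast_nonneg _) h1 2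
      rw [Real.sq_sqrt hW0.le] at h2
      exact_mod_cast h2
    have := hP23 (d ^ 2) he1 heW ((d : ℝ) ^ 2 * α)
    rw [natCast_sq_rpow_three_quarters] at this
    refine this.trans (le_of_eq ?_)
    have hs : 0 < Real.sqrt d ^ 3 := pow_pos (Real.sqrt_pos.mpr (by exact_mod_cast hd.1)) 3
    field_simp
  -- step 4: for `d > M`, pair counting
  have hlarge : ∀ d ∈ Ioc M D, ∑ k ∈ Icc 1 X, ‖T d k‖ ≤ 2 * ((H : ℝ) * X) * ((d : ℝ) ^ 2)⁻¹ := by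
    intro d hd
    rw [Finset.mem_Ioc] at hd
    have hd0 : (0 : ℝ) < d := by exact_mod_cast (by omega : 0 < d)
    calc ∑ k ∈ Icc 1 X, ‖T d k‖ ≤ ∑ k ∈ Icc 1 X, (#(windowDiv (d ^ 2) H k) : ℝ) :=
          Finset.sum_le_sum fun k _ => htriv d k
      _ ≤ (H : ℝ) * ((X : ℝ) + H) / ((d ^ 2 : ℕ) : ℝ) :=
          sum_card_windowDiv_le X H (d ^ 2) (Nat.one_le_pow _ _ (by omega)) hH
      _ ≤ (H : ℝ) * ((X : ℝ) + X) / ((d ^ 2 : ℕ) : ℝ) := by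
          apply div_le_div_of_nonneg_right _ (by positivity)
          exact mul_le_mul_of_nonneg_left (by linarith) hH0
      _ = 2 * ((H : ℝ) * X) * ((d : ℝ) ^ 2)⁻¹ := by push_cast; ring
  -- step 5: assemble
  have hsum_small : ∑ d ∈ Icc 1 M, ∑ k ∈ Icc 1 X, ‖T d k‖ ≤ 3 * C * ((H : ℝ) * X / W ^ (1 / 5 : ℝ)) := by
    calc ∑ d ∈ Icc 1 M, ∑ k ∈ Icc 1 X, ‖T d k‖
        ≤ ∑ d ∈ Icc 1 M, C * ((H : ℝ) * X / W ^ (1 / 5 : ℝ)) * (Real.sqrt d ^ 3)⁻¹ :=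
          Finset.sum_le_sum hsmall
      _ = C * ((H : ℝ) * X / W ^ (1 / 5 : ℝ)) * ∑ d ∈ Icc 1 M, (Real.sqrt d ^ 3)⁻¹ := by
          rw [Finset.mul_sum]
      _ ≤ C * ((H : ℝ) * X / W ^ (1 / 5 : ℝ)) * 3 := by
          apply mul_le_mul_of_nonneg_left _ (by positivity)
          have := sum_inv_sqrt_cube_le M hM1
          have : 0 ≤ 2 / Real.sqrt M := by positivity
          linarith
      _ = 3 * C * ((H : ℝ) * X / W ^ (1 / 5 : ℝ)) := by ring
  have hsum_large : ∑ d ∈ Ioc M D, ∑ k ∈ Icc 1 X, ‖T d k‖ ≤ 4 * ((H : ℝ) * X / W ^ (1 / 5 : ℝ)) := by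
    rcases le_or_gt M D with hMD | hMD
    · calc ∑ d ∈ Ioc M D, ∑ k ∈ Icc 1 X, ‖T d k‖
          ≤ ∑ d ∈ Ioc M D, 2 * ((H : ℝ) * X) * ((d : ℝ) ^ 2)⁻¹ := Finset.sum_le_sum hlarge
        _ = 2 * ((H : ℝ) * X) * ∑ d ∈ Ioc M D, ((d : ℝ) ^ 2)⁻¹ := by rw [Finset.mul_sum]
        _ ≤ 2 * ((H : ℝ) * X) * (M : ℝ)⁻¹ := by
            apply mul_le_mul_of_nonneg_left _ (by positivity)
            have h1 := sum_Ioc_inv_sq_le_sub (α := ℝ) (by omega : M ≠ 0) hMD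
            have h2 : 0 ≤ (D : ℝ)⁻¹ := by positivity
            linarith
        _ ≤ 2 * ((H : ℝ) * X) * (2 / Real.sqrt W) := by
            apply mul_le_mul_of_nonneg_left _ (by positivity)
            rw [inv_eq_one_div, div_le_div_iff₀ hM0 (by linarith)]
            linarith
        _ = 4 * ((H : ℝ) * X) / Real.sqrt W := by ring
        _ ≤ 4 * ((H : ℝ) * X) / W ^ (1 / 5 : ℝ) := by
            apply div_le_div_of_nonneg_left (by positivity) hW5
            rw [Real.sqrt_eq_rpow]
            exact Real.rpow_le_rpow_of_exponent_le hW1 (by norm_num)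
        _ = 4 * ((H : ℝ) * X / W ^ (1 / 5 : ℝ)) := by ring
    · rw [Finset.Ioc_eq_empty (by omega), Finset.sum_empty]
      positivity
  have hnn : ∀ d ∈ Icc 1 D, 0 ≤ ∑ k ∈ Icc 1 X, ‖T d k‖ := fun d _ =>
    Finset.sum_nonneg fun k _ => norm_nonneg _
  calc ∑ k ∈ Icc 1 X, ‖moebiusTwistedSum ((Icc k (k + H - 1)).filter S) α‖
      ≤ ∑ k ∈ Icc 1 X, ∑ d ∈ Icc 1 D, ‖T d k‖ := Finset.sum_le_sum hstep1
    _ = ∑ d ∈ Icc 1 D, ∑ k ∈ Icc 1 X, ‖T d k‖ := Finset.sum_comm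
    _ = ∑ d ∈ (Icc 1 D).filter (fun d => d ≤ M), ∑ k ∈ Icc 1 X, ‖T d k‖ +
          ∑ d ∈ (Icc 1 D).filter (fun d => ¬ d ≤ M), ∑ k ∈ Icc 1 X, ‖T d k‖ :=
        (Finset.sum_filter_add_sum_filter_not _ _ _).symm
    _ ≤ ∑ d ∈ Icc 1 M, ∑ k ∈ Icc 1 X, ‖T d k‖ + ∑ d ∈ Ioc M D, ∑ k ∈ Icc 1 X, ‖T d k‖ := by
        apply add_le_add
        · refine Finset.sum_le_sum_of_subset_of_nonneg ?_ fun d _ _ =>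
            Finset.sum_nonneg fun k _ => norm_nonneg _
          intro d hd
          rw [Finset.mem_filter, Finset.mem_Icc] at hd
          rw [Finset.mem_Icc]
          exact ⟨hd.1.1, hd.2⟩
        · refine Finset.sum_le_sum_of_subset_of_nonneg ?_ fun d _ _ =>
            Finset.sum_nonneg fun k _ => norm_nonneg _
          intro d hd
          rw [Finset.mem_filter, Finset.mem_Icc] at hd
          rw [Finset.mem_Ioc]
          exact ⟨by omega, hd.1.2⟩
    _ ≤ 3 * C * ((H : ℝ) * X / W ^ (1 / 5 : ℝ)) + 4 * ((H : ℝ) * X / W ^ (1 / 5 : ℝ)) :=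
        add_le_add hsum_small hsum_large
    _ = (3 * C + 4) * ((H : ℝ) * X / W ^ (1 / 5 : ℝ)) := by ring

end Literature.NumberTheory.Sieve.Lichtman2020

namespace Literature.NumberTheory.Sieve.Lichtman2020

/-! ### Invariance of `S` under small square factors -/

/-- Multiplying by a number all of whose prime factors are `< P` does not change the presence of a
prime factor in `[P, Q]`. [folklore] -/
theorem hasPrimeFactorIn_mul_iff {P Q : ℝ} {d m : ℕ} (hd : d ≠ 0)
    (hsmall : ∀ p ∈ d.primeFactors, (p : ℝ) < P) :
    HasPrimeFactorIn P Q (d * m) ↔ HasPrimeFactorIn P Q m := by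
  rcases Nat.eq_zero_or_pos m with rfl | hm
  · rw [Nat.mul_zero]
  unfold HasPrimeFactorIn
  rw [Nat.primeFactors_mul hd hm.ne']
  constructor
  · rintro ⟨p, hp, hP, hQ⟩
    rcases Finset.mem_union.mp hp with h | h
    · exact absurd hP (not_le.mpr (hsmall p h))
    · exact ⟨p, h, hP, hQ⟩
  · rintro ⟨p, hp, hP, hQ⟩
    exact ⟨p, Finset.mem_union.mpr (Or.inr hp), hP, hQ⟩

/-- If every prime `p ≤ d` is `< P₁` and `< P₂` (`d ≥ 1`), then `d²m ∈ S ↔ m ∈ S`. [folklore] -/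
theorem lichtmanTypical_sq_mul_iff {X A δ Hr : ℝ} {d : ℕ} (hd : 1 ≤ d)
    (h1 : (d : ℝ) < Real.log X ^ (33 * A))
    (h2 : (d : ℝ) < Real.exp (Real.log X ^ (2 / 3 + δ / 2))) (m : ℕ) :
    lichtmanTypical X A δ Hr (d ^ 2 * m) ↔ lichtmanTypical X A δ Hr m := by
  have hd0 : d ^ 2 ≠ 0 := pow_ne_zero 2 (by omega)
  have hp : ∀ p ∈ (d ^ 2).primeFactors, (p : ℝ) ≤ d := fun p hp => by
    rw [Nat.primeFactors_pow _ two_ne_zero] at hp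
    exact_mod_cast Nat.le_of_mem_primeFactors hp
  unfold lichtmanTypical
  rw [hasPrimeFactorIn_mul_iff hd0 (fun p hp' => (hp p hp').trans_lt h1),
    hasPrimeFactorIn_mul_iff hd0 (fun p hp' => (hp p hp').trans_lt h2)]

/-! ### Eventual inequalities -/

/-- `log X → ∞` along `ℕ`. [folklore] -/
theorem tendsto_log_natCast : Tendsto (fun X : ℕ => Real.log X) atTop atTop :=
  Real.tendsto_log_atTop.comp tendsto_natCast_atTop_atTop

/-- For `u ≥ 1` and `ε > 0`: `log u ≤ u^ε / ε`. [folklore] -/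
theorem log_le_rpow_div' {u ε : ℝ} (hu : 1 ≤ u) (hε : 0 < ε) : Real.log u ≤ u ^ ε / ε := by
  have hu0 : 0 < u := by linarith
  have h := Real.log_le_sub_one_of_pos (Real.rpow_pos_of_pos hu0 ε)
  rw [Real.log_rpow hu0] at h
  rw [le_div_iff₀ hε]
  linarith

/-- Eventually `(log X)^{A/2} < exp((log X)^{2/3 + δ/2})` (`δ > 0`). [folklore] -/
theorem eventually_sqrtW_lt_P2 (A δ : ℝ) (hδ : 0 < δ) :
    ∀ᶠ X : ℕ in atTop, Real.log X ^ (A / 2) < Real.exp (Real.log X ^ (2 / 3 + δ / 2)) := by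
  have h1 : ∀ᶠ X : ℕ in atTop, 3 * |A| / 4 + 1 ≤ Real.log X ^ (δ / 2) :=
    ((tendsto_rpow_atTop (by linarith : 0 < δ / 2)).comp tendsto_log_natCast).eventually_ge_atTop _
  filter_upwards [h1, tendsto_log_natCast.eventually_ge_atTop 1] with X hX hL
  set u := Real.log (X : ℝ) with hu
  have hu0 : 0 < u := by linarith
  rw [Real.rpow_def_of_pos hu0, Real.exp_lt_exp]
  -- `log u · (A/2) ≤ (3/2) u^{2/3} · |A|/2 < u^{2/3} u^{δ/2}`
  have hlog : Real.log u ≤ u ^ (2 / 3 : ℝ) / (2 / 3) := log_le_rpow_div' hL (by norm_num)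
  have hlog0 : 0 ≤ Real.log u := Real.log_nonneg hL
  have h23 : 0 < u ^ (2 / 3 : ℝ) := Real.rpow_pos_of_pos hu0 _
  have hsplit : u ^ (2 / 3 + δ / 2) = u ^ (2 / 3 : ℝ) * u ^ (δ / 2) := Real.rpow_add hu0 _ _
  rw [hsplit]
  calc Real.log u * (A / 2) ≤ Real.log u * (|A| / 2) := by
        apply mul_le_mul_of_nonneg_left _ hlog0
        linarith [le_abs_self A]
    _ ≤ (u ^ (2 / 3 : ℝ) / (2 / 3)) * (|A| / 2) :=
        mul_le_mul_of_nonneg_right hlog (by positivity)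
    _ = u ^ (2 / 3 : ℝ) * (3 * |A| / 4) := by ring
    _ < u ^ (2 / 3 : ℝ) * u ^ (δ / 2) := mul_lt_mul_of_pos_left (by linarith) h23

end Literature.NumberTheory.Sieve.Lichtman2020

namespace Literature.NumberTheory.Sieve

open Lichtman2020 in
/-- **Lichtman 2020, Theorem 2.2 from Proposition 2.3** ("Proof of Theorem 2.2 from
Proposition 2.3", p. 8): the named fact `Lichtman2020_keyFourierEstimateLiouville` (Prop 2.3, for
the completely multiplicative `λ`) implies the named fact `Lichtman2020_keyFourierEstimate`
(Thm 2.2, for `μ`).  By `μ(n) = ∑_{d² ∣ n} μ(d) λ(n/d²)` (`moebius_eq_sum_sq_dvd`) and the triangle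
inequality, the window sums for `μ` are bounded by those for `λ` over the divided windows
`{m : x ≤ d²m ≤ x + H}`; for `d² ≤ W = (log X)^A` one has `𝟙_S(d²m) = 𝟙_S(m)` (`d² < P₁ ≤ P₂`) and
Proposition 2.3 applies with the saving `d^{-3/2} W^{-1/5}`, `∑_d d^{-3/2} ≤ 3`; for `d² > W` the
trivial bound and `∑_k #window ≤ 2HX/d²`, `∑_{d > √W} d⁻² ≤ 2/√W` give `≪ HX/√W ≤ HX/W^{1/5}`.  The
integrals are evaluated exactly as finite sums (`integral_window_eq_sum`,
`integral_window_div_eq_sum`), the integrands being step functions. [cite: Lichtman2020, Theorem 2.2 and Proposition 2.3] -/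
theorem Lichtman2020_keyFourierEstimate_of_liouville
    (h23 : Lichtman2020_keyFourierEstimateLiouville) : Lichtman2020_keyFourierEstimate := by
  intro A hA δ hδ H hH hHexp
  have hA0 : 0 < A := by linarith
  -- the hypothesis `ψ ≤ (log X)^{2/3}` of Proposition 2.3 from `H ≤ exp((log X)^{2/3})`
  have hone := eventually_one_le_H hH
  have hll : ∀ᶠ X : ℕ in atTop, 1 ≤ Real.log (Real.log X) :=
    (Real.tendsto_log_atTop.comp tendsto_log_natCast).eventually_ge_atTop 1
  have hψ : ∀ᶠ X : ℕ in atTop,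
      Real.log (H X) / Real.log (Real.log X) ≤ Real.log X ^ (2 / 3 : ℝ) := by
    filter_upwards [hHexp, hone, hll, tendsto_log_natCast.eventually_ge_atTop 1] with X hX h1 h2 h3
    have hH0 : (0 : ℝ) < H X := by exact_mod_cast h1
    have hlogH : Real.log (H X) ≤ Real.log X ^ (2 / 3 : ℝ) := by
      have := Real.log_le_log hH0 hX
      rwa [Real.log_exp] at this
    have hr0 : 0 ≤ Real.log X ^ (2 / 3 : ℝ) := Real.rpow_nonneg (by linarith) _
    rw [div_le_iff₀ (by linarith)]
    calc Real.log (H X) ≤ Real.log X ^ (2 / 3 : ℝ) := hlogH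
      _ = Real.log X ^ (2 / 3 : ℝ) * 1 := (mul_one _).symm
      _ ≤ Real.log X ^ (2 / 3 : ℝ) * Real.log (Real.log X) := mul_le_mul_of_nonneg_left h2 hr0
  obtain ⟨C, hC⟩ := h23 A hA δ hδ H hH hψ
  refine ⟨3 * max C 0 + 4, ?_⟩
  have hW4 : ∀ᶠ X : ℕ in atTop, 4 ≤ Real.log X ^ A :=
    ((tendsto_rpow_atTop hA0).comp tendsto_log_natCast).eventually_ge_atTop 4
  filter_upwards [hC, hHexp, hone, hW4, tendsto_log_natCast.eventually_gt_atTop 1,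
    eventually_sqrtW_lt_P2 A δ hδ, eventually_gt_atTop 0] with X hCX hHX h1 hW4X hL1 hP2 hX0 α
  -- notation and basic facts at this `X`
  have hX0' : (0 : ℝ) < X := by exact_mod_cast hX0
  have hL0 : 0 < Real.log X := by linarith
  set W : ℝ := Real.log X ^ A with hW
  have hW0 : 0 < W := by rw [hW]; exact Real.rpow_pos_of_pos hL0 _
  have hW15 : W ^ (1 / 5 : ℝ) = Real.log X ^ (A / 5) := by
    rw [hW, ← Real.rpow_mul hL0.le]; ring_nf
  have hHleX : H X ≤ X := by
    have h2 : Real.log X ^ (2 / 3 : ℝ) ≤ Real.log X := by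
      calc Real.log X ^ (2 / 3 : ℝ) ≤ Real.log X ^ (1 : ℝ) :=
            Real.rpow_le_rpow_of_exponent_le hL1.le (by norm_num)
        _ = Real.log X := Real.rpow_one _
    have h3 : (H X : ℝ) ≤ X := by
      calc (H X : ℝ) ≤ Real.exp (Real.log X ^ (2 / 3 : ℝ)) := hHX
        _ ≤ Real.exp (Real.log X) := Real.exp_le_exp.mpr h2
        _ = X := Real.exp_log hX0'
    exact_mod_cast h3
  -- the integral as a finite sum
  rw [integral_window_eq_sum (fun s => ‖moebiusTwistedSum (s.filter (lichtmanTypical X A δ (H X))) α‖)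
    X (H X) h1]
  -- the square-invariance of `S` for `d ≤ M = ⌊√W⌋`
  set M : ℕ := ⌊Real.sqrt W⌋₊ with hM
  have hMle : (M : ℝ) ≤ Real.sqrt W := Nat.floor_le (Real.sqrt_nonneg _)
  have hsqrtW : Real.sqrt W = Real.log X ^ (A / 2) := by
    rw [Real.sqrt_eq_rpow, hW, ← Real.rpow_mul hL0.le]; ring_nf
  have hS : ∀ d : ℕ, 1 ≤ d → d ≤ M → ∀ m : ℕ,
      lichtmanTypical X A δ (H X) (d ^ 2 * m) ↔ lichtmanTypical X A δ (H X) m := by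
    intro d hd hdM m
    have hdW : (d : ℝ) ≤ Real.log X ^ (A / 2) := by
      rw [← hsqrtW]; exact le_trans (by exact_mod_cast hdM) hMle
    refine lichtmanTypical_sq_mul_iff hd (lt_of_le_of_lt hdW ?_) (lt_of_le_of_lt hdW hP2) m
    exact Real.rpow_lt_rpow_of_exponent_lt hL1 (by linarith)
  -- Proposition 2.3 in discretised form at this `X`
  have hP23 : ∀ e : ℕ, 1 ≤ e → (e : ℝ) ≤ W → ∀ β : ℝ,
      ∑ k ∈ Icc 1 X, ‖liouvilleTwistedSum ((windowDiv e (H X) k).filter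
          (lichtmanTypical X A δ (H X))) β‖ ≤
        max C 0 * ((H X : ℝ) * X / ((e : ℝ) ^ (3 / 4 : ℝ) * W ^ (1 / 5 : ℝ))) := by
    intro e he heW β
    have h := hCX e he heW β
    rw [integral_window_div_eq_sum (fun s => ‖liouvilleTwistedSum (s.filter
      (lichtmanTypical X A δ (H X))) β‖) X (H X) e he] at h
    rw [hW15]
    refine h.trans (mul_le_mul_of_nonneg_right (le_max_left _ _) ?_)
    have : 0 < (e : ℝ) ^ (3 / 4 : ℝ) := Real.rpow_pos_of_pos (by exact_mod_cast he) _
    positivity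
  have hmain := keyFourier_fixed_bound (lichtmanTypical X A δ (H X)) α h1 hHleX hW4X hM le_rfl
    (le_max_right C 0) hP23 hS
  rw [hW15] at hmain
  exact hmain

end Literature.NumberTheory.Sieve
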